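import Literature.AlgebraicGeometry.Motives.GeneratingSectionsSubfamilyEmbedding
import Literature.AlgebraicGeometry.Motives.GeneratingSectionsOfLineBundle
import Literature.AlgebraicGeometry.Modules.DetClassOfIso
import HarnessLib

/-!
# The generating-sections datum of `(E, t)` is invariant under an isomorphism `E ≅ E'` of line bundles

Topic `AlgebraicGeometry/Motives`; namespace `Literature.AlgebraicGeometry.Motives.GeneratingSections`.  THEOREMS ONLY (no definition,
no instance, no notation, no named fact, no `sorry`).  Cell `hodgecm-mathlib` (D-0151), F-6 functor side (FS-b) FILE 1 (B-p06 (g12); census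
`B-provers/B-p06/g12/CENSUS-FSb-PolarizedLevelFrameEmbedding.B-p06g12.md`): count-neutral Mathlib-side capital — HC_CM is proved only
modulo the 7 printed citations until rung 0 closes; nothing here is about HC.

[Hartshorne1977] II, proof of Thm. 7.1: the morphism `X → ℙ^m` attached to a line bundle `E` with local generators and global sections
`t₀, …, t_m` is read off the COEFFICIENTS `t_i|_{U_x} = c_i(x) · b_x` (the tree's ★ `coeffAt` / `CocycleSections.ofFrameSystem`), and «does
not depend on the trivialisation»; in particular it only depends on the isomorphism class of the pair `(E, t)`.  Here: for an isomorphism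
`φ : E ≅ E'` of `𝒪_X`-modules, transport a frame system `F` of `E` to `E'` (frames `𝒪^{I_x} ≅ E|_{U_x} ≅ E'|_{U_x}`, same opens, same
index sets — the construction of ★ `Modules.hasRank_of_iso` / `detClass_eq_of_iso`) and the sections `t_i` to `φ(t_i)`; then

* `coord_trans_overFunctor_mapIso` — coordinates in a transported frame are the coordinates of the preimage;
* **`coeffAt_transport`** — the coefficients do not change: `c'_i(x) = c_i(x)`;
* **`ofFrameSystem_transport`** — hence the `CocycleSections` data are EQUAL, so the covering hypotheses `hcov` and the generating-sections
  data `ofCocycleSections …` (and the morphisms `toProj` to projective space built from them) coincide — stated for any frame system `F'` of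
  `E'` whose frames are the transported ones (`hF'`), so that no definition is introduced.

Consumer: the F-6 functor side ((FS-b) `AbelianSchemes/PolarizedLevelFrameEmbedding`): at a geometric fibre `ι_s̄^*(L^Δ(λ)^{⊗3}) ≅ 𝒪(3Θ)`
(★ `AbelianSchemeLDeltaFibreH1Vanishing` §2) and the Lefschetz embedding is stated for `𝒪(3Θ)`.

## References
* [Hartshorne1977] R. Hartshorne, *Algebraic Geometry* (1977), II Thm. 7.1 and its proof (p. 150); II Ex. 5.18 (d).
* [GortzWedhorn2020] U. Görtz, T. Wedhorn, *Algebraic Geometry I*, 2nd ed. (2020), Prop. 11.15 and Rem. 11.16 (p. 298).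
-/

open CategoryTheory Opposite TopologicalSpace AlgebraicGeometry

universe u

noncomputable section

-- `TopCat.Presheaf`/`Scheme.Modules` are not reducible (as in Mathlib's `AlgebraicGeometry/Modules`).
set_option backward.isDefEq.respectTransparency false

namespace Literature.AlgebraicGeometry.Motives

namespace GeneratingSections

open Literature.AlgebraicGeometry.Modules

variable {X : Scheme.{u}} {E E' : X.Modules} (φ : E ≅ E')

/-- **Coordinates in a transported frame are the coordinates of the preimage**: for a frame `e : 𝒪^I ≅ E|_W` and `φ : E ≅ E'`, the
coordinates of `s ∈ Γ(E', V)` in the frame `e ≫ φ|_W` of `E'` are those of `φ⁻¹(s)` in `e` (the dual basis of the transported frame is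
the dual basis precomposed with `φ⁻¹`). [cite: GortzWedhorn2020, Prop. 11.15 and Rem. 11.16 (p. 298)] -/
theorem coord_trans_overFunctor_mapIso {W V : X.Opens} {I : Type u} (e : SheafOfModules.free I ≅ E.over W) (k : V ⟶ W)
    (s : Γ(E', V)) (i : I) :
    coord (e ≪≫ (SheafOfModules.overFunctor _ W).mapIso φ) k s i =
      coord e k (appLE ((SheafOfModules.overFunctor _ W).mapIso φ).inv k s) i := by
  unfold coord dualBasis homOfBasisValues
  rw [Iso.trans_inv, Category.assoc, appLE_comp]

variable (F : FrameSystem E) (F' : FrameSystem E') (hU : F'.U = F.U) (h : ∀ x, F.rank x = 1) (h' : ∀ x, F'.rank x = 1)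
  {ι : Type} (t : ι → Γ(E, ⊤))

/-- `φ⁻¹|_W (φ(t)|_V) = t|_V`. [folklore] -/
private theorem appLE_mapIso_inv_map_app {W V : X.Opens} (k : V ⟶ W) (s : Γ(E, ⊤)) :
    appLE ((SheafOfModules.overFunctor _ W).mapIso φ).inv k (E'.presheaf.map (homOfLE (le_top : V ≤ ⊤)).op (φ.hom.app ⊤ s)) =
      E.presheaf.map (homOfLE (le_top : V ≤ ⊤)).op s := by
  have h1 : E'.presheaf.map (homOfLE (le_top : V ≤ ⊤)).op (φ.hom.app ⊤ s) =
      φ.hom.app V (E.presheaf.map (homOfLE (le_top : V ≤ ⊤)).op s) := by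
    have h := ConcreteCategory.congr_hom (φ.hom.mapPresheaf.naturality (homOfLE (le_top : V ≤ ⊤)).op) s
    rw [ConcreteCategory.comp_apply, ConcreteCategory.comp_apply] at h
    exact h.symm
  rw [h1, Functor.mapIso_inv, ← appLE_over_map φ.hom k, ← appLE_comp, ← Functor.map_comp, Iso.hom_inv_id,
    CategoryTheory.Functor.map_id, appLE_id]

/-- **The coefficients of global sections do not change under transport along `φ : E ≅ E'`**: reading `φ(t_i)` in the transported
frames `𝒪 ≅ E|_{U_x} ≅ E'|_{U_x}` gives the same functions `c_i(x) ∈ Γ(X, U_x)` as reading `t_i` in the frames of `F`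
(Hartshorne: «`s = f · s₀`» is preserved by an isomorphism of pairs `(E, t) ≅ (E', φ t)`). [cite: Hartshorne1977, II proof of Thm. 7.1]
[cite: GortzWedhorn2020, Prop. 11.15 and Rem. 11.16 (p. 298)] -/
theorem coeffAt_transport (i : ι) (x : X) :
    coeffAt (E := E')
        { U := F.U, mem := F.mem, I := F.I, rank := F.rank, enum := F.enum,
          frame := fun x => F.frame x ≪≫ (SheafOfModules.overFunctor _ (F.U x)).mapIso φ } h
        (fun i => φ.hom.app ⊤ (t i)) i x =
      coeffAt F h t i x := by
  change coord (F.frame x ≪≫ (SheafOfModules.overFunctor _ (F.U x)).mapIso φ) (𝟙 (F.U x))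
      (E'.presheaf.map (homOfLE le_top).op (φ.hom.app ⊤ (t i))) (F.idx h x) =
    coord (F.frame x) (𝟙 (F.U x)) (E.presheaf.map (homOfLE le_top).op (t i)) (F.idx h x)
  rw [coord_trans_overFunctor_mapIso, appLE_mapIso_inv_map_app]

/-- **The `CocycleSections` datum of `(E', φ t)` in the transported frames EQUALS that of `(E, t)`** (same coefficients, ★
`CocycleSections.ext`); in particular the covering conditions `⨆ X_{c_i(x)} = ⊤` and the generating-sections data / morphisms to
projective space built from them are the same. [cite: Hartshorne1977, II Thm. 7.1 and its proof] -/
theorem ofFrameSystem_transport :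
    CocycleSections.ofFrameSystem (E := E')
        { U := F.U, mem := F.mem, I := F.I, rank := F.rank, enum := F.enum,
          frame := fun x => F.frame x ≪≫ (SheafOfModules.overFunctor _ (F.U x)).mapIso φ } h
        (fun i => φ.hom.app ⊤ (t i)) =
      CocycleSections.ofFrameSystem F h t := by
  ext i x
  rw [CocycleSections.ofFrameSystem_coeff, CocycleSections.ofFrameSystem_coeff, coeffAt_transport]

/-- The covering condition «the `φ(t_i)` generate `E'`» (read in the transported frames) is literally the covering condition «the
`t_i` generate `E`». [cite: Hartshorne1977, II Thm. 7.1] -/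
theorem iSup_basicOpen_coeff_transport :
    ⨆ i, ⨆ x, X.basicOpen ((CocycleSections.ofFrameSystem (E := E')
        { U := F.U, mem := F.mem, I := F.I, rank := F.rank, enum := F.enum,
          frame := fun x => F.frame x ≪≫ (SheafOfModules.overFunctor _ (F.U x)).mapIso φ } h
        (fun i => φ.hom.app ⊤ (t i))).coeff i x) =
      ⨆ i, ⨆ x, X.basicOpen ((CocycleSections.ofFrameSystem F h t).coeff i x) := by
  rw [ofFrameSystem_transport]

/-- **The generating-sections datum — hence the morphism to projective space — of `(E', φ t)` is that of `(E, t)`**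
(for any proofs of the covering conditions). [cite: Hartshorne1977, II Thm. 7.1 and its proof] -/
theorem ofCocycleSections_transport
    (hcov : ⨆ i, ⨆ x, X.basicOpen ((CocycleSections.ofFrameSystem F h t).coeff i x) = ⊤)
    (hcov' : ⨆ i, ⨆ x, X.basicOpen ((CocycleSections.ofFrameSystem (E := E')
        { U := F.U, mem := F.mem, I := F.I, rank := F.rank, enum := F.enum,
          frame := fun x => F.frame x ≪≫ (SheafOfModules.overFunctor _ (F.U x)).mapIso φ } h
        (fun i => φ.hom.app ⊤ (t i))).coeff i x) = ⊤) :
    ofCocycleSections F.U (CocycleSections.ofFrameSystem (E := E')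
        { U := F.U, mem := F.mem, I := F.I, rank := F.rank, enum := F.enum,
          frame := fun x => F.frame x ≪≫ (SheafOfModules.overFunctor _ (F.U x)).mapIso φ } h
        (fun i => φ.hom.app ⊤ (t i))) hcov' =
      ofCocycleSections F.U (CocycleSections.ofFrameSystem F h t) hcov := by
  have key : ∀ (S : CocycleSections ι F.U) (hS : ⨆ i, ⨆ x, X.basicOpen (S.coeff i x) = ⊤),
      S = CocycleSections.ofFrameSystem F h t → ofCocycleSections F.U S hS =
        ofCocycleSections F.U (CocycleSections.ofFrameSystem F h t) hcov := by
    rintro _ _ rfl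
    rfl
  exact key _ hcov' (ofFrameSystem_transport φ F h t)

/-- … and the same morphism `toProj f` to projective space over any base. [cite: Hartshorne1977, II Thm. 7.1 and its proof] -/
theorem toProj_transport {k : Type u} [CommRing k] (f : X ⟶ Spec (.of k)) [Fintype ι]
    (hcov : ⨆ i, ⨆ x, X.basicOpen ((CocycleSections.ofFrameSystem F h t).coeff i x) = ⊤)
    (hcov' : ⨆ i, ⨆ x, X.basicOpen ((CocycleSections.ofFrameSystem (E := E')
        { U := F.U, mem := F.mem, I := F.I, rank := F.rank, enum := F.enum,
          frame := fun x => F.frame x ≪≫ (SheafOfModules.overFunctor _ (F.U x)).mapIso φ } h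
        (fun i => φ.hom.app ⊤ (t i))).coeff i x) = ⊤) :
    (ofCocycleSections F.U (CocycleSections.ofFrameSystem (E := E')
        { U := F.U, mem := F.mem, I := F.I, rank := F.rank, enum := F.enum,
          frame := fun x => F.frame x ≪≫ (SheafOfModules.overFunctor _ (F.U x)).mapIso φ } h
        (fun i => φ.hom.app ⊤ (t i))) hcov').toProj f =
      (ofCocycleSections F.U (CocycleSections.ofFrameSystem F h t) hcov).toProj f := by
  rw [ofCocycleSections_transport]

end GeneratingSections

end Literature.AlgebraicGeometry.Motives

end
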